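import Literature.AlgebraicGeometry.Motives.CartierDivisorEffective
import Literature.AlgebraicGeometry.Motives.CartierDivisorAmple
import Literature.AlgebraicGeometry.Motives.AbelianVarietyDegreePullback
import HarnessLib

/-!
# A class map for Cartier divisors: bookkeeping in `DivCl(X)` and embeddings of sections

`Motives/CartierDivisor` presents Cartier divisors `D = (U_i, f_i)` on an integral scheme `X`
(Görtz–Wedhorn I, Def. 11.20) without passing to the quotient `Div(X)`, let alone
`DivCl(X) = Div(X)/∼ ≅ Pic(X)` (Prop. 11.21); sums are associative and commutative only up to
`SameDivisor`, and identities between divisor classes have so far been manipulated by hand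
(`LinEquiv.of_cube_step` in `Motives/AbelianVarietyCube`). For the quadratic bookkeeping behind the
degree bound of Mumford §19 (`Motives/AbelianVarietyEndDegreeBound`) this file provides, without
introducing any definition:

* `CartierDivisor.exists_classMap` — there is an abelian group `Q` and a map `cl : Div(X) → Q` on
  presentations with `cl (D + E) = cl D + cl E` and `D ∼ E ↔ cl D = cl E`, i.e. an embedding of
  `DivCl(X)` into an honest `AddCommGroup` (concretely `Q = (∏_x K(X)^×/𝒪_{X,x}^×)/K(X)^×`, germs of
  local equations modulo principal divisors). All later statements take such a pair `(Q, cl)` as a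
  hypothesis, so they apply to any model of the class group;
* the resulting calculus: `classMap_zero`, `classMap_smul`, and the existence of *effective* resp.
  *ample* representatives of `ℕ`-combinations of effective resp. ample classes
  (`exists_isEffective_classMap_eq_sum`, `exists_isAmple_classMap_eq_add_sum`);
* **from class identities to sections**: if `cl A = cl B + cl R` with `R` effective then
  `Γ(X, 𝒪(m B)) ↪ Γ(X, 𝒪(m A))` `K`-linearly for all `m` (`exists_injective_of_classMap_eq_add`;
  multiplication by the canonical section of `m R`, Görtz–Wedhorn I, (11.12)), with the pieces
  `smul_add_sameDivisor`, `nonempty_sectionsEquiv_of_linEquiv`,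
  `exists_injective_sections_add_of_isEffective`;
* **comparison of asymptotic degrees** (`le_of_injective_sections`): if
  `h⁰(m P) = δ_P m^g/g! + O(m^{g-1})`, `h⁰(m H) = δ_H m^g/g! + O(m^{g-1})` with `δ_H > 0`
  (`CartierDivisor.HasAsympDegree`, the shape of Görtz–Wedhorn II, Prop. 23.83) and
  `Γ(𝒪(m P)) ↪ Γ(𝒪(m (M H)))` for `m ≫ 0`, then `δ_P ≤ δ_H M^g`;
* `IsAmple.exists_isAmple_isEffective` — an ample divisor is linearly equivalent to an effective
  ample one (the divisor of a nonzero section of a multiple, Görtz–Wedhorn I, Prop. 13.47).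

Mathlib searched (pin): `QuotientGroup.eq`, `QuotientGroup.mk_mul`, `Units.map`, `Units.mk0`,
`Additive.ofMul` (used for the model of `Q`); `LinearMap.finrank_le_finrank_of_injective`,
`le_of_tendsto_of_tendsto` (used); Mathlib has no `Pic`/`DivCl` of a scheme.

## References

* U. Görtz, T. Wedhorn, *Algebraic Geometry I: Schemes*, 2nd ed. (2020): (11.9) Def. 11.20,
  Prop. 11.21 (`DivCl(X) ≅ Pic(X)` for integral `X`), p. 374; (11.12), pp. 377–378; Prop. 13.47,
  pp. 493–494. [GortzWedhorn2020]
* U. Görtz, T. Wedhorn, *Algebraic Geometry II: Cohomology of Schemes* (2023): Prop. 23.83,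
  p. 447 (the asymptotic shape compared in `le_of_injective_sections`). [GortzWedhorn2023]

## Design

No definitions, no named facts: the class group enters only through the existential
`exists_classMap`, whose witness is built inside the proof from Mathlib's quotient groups.
-/

universe u

open CategoryTheory AlgebraicGeometry Filter Topology Asymptotics
open Literature.AlgebraicGeometry.Motives.RatFn

noncomputable section

namespace Literature.AlgebraicGeometry.Motives

namespace CartierDivisor

/-! ### An additive class map identifying exactly the linearly equivalent divisors -/

/-- **An additive class map identifying exactly the linearly equivalent divisors.** On an integral
scheme `X` there is an abelian group `Q` and a map `cl : Div(X) → Q` on presentations of Cartier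
divisors which is additive and satisfies `D ∼ E ↔ cl D = cl E` — i.e. `cl` induces an embedding of
`DivCl(X) = Div(X)/∼` (Görtz–Wedhorn I, (11.9) and Prop. 11.21, p. 374) into `Q`. Concretely `Q` is
the quotient of `∏_{x ∈ X} K(X)^× / 𝒪_{X,x}^×` (germs of local equations; independent of the chart
by the cocycle condition) by the diagonal image of `K(X)^×` (principal divisors), and
`cl D = ((f_i)_x)_x` for any chart `U_i ∋ x`. [cite: GortzWedhorn2020, Prop. 11.21 (p. 374)] -/
theorem exists_classMap (X : Scheme.{u}) [IsIntegral X] :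
    ∃ (Q : Type u) (_ : AddCommGroup Q) (cl : CartierDivisor X → Q),
      (∀ D E : CartierDivisor X, cl (D + E) = cl D + cl E) ∧
      (∀ D E : CartierDivisor X, D.LinEquiv E ↔ cl D = cl E) := by
  classical
  -- units at `x`, as a subgroup of `K(X)ˣ`
  let U : X → Subgroup (X.functionField)ˣ := fun x =>
    (Units.map (toFunctionField x).toMonoidHom).range
  have hU : ∀ (x : X) (v : (X.functionField)ˣ), v ∈ U x ↔ IsUnitAt x (v : X.functionField) := by
    intro x v
    constructor
    · rintro ⟨w, hw⟩
      exact ⟨w, by rw [← hw]; rfl⟩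
    · rintro ⟨w, hw⟩
      exact ⟨w, Units.ext hw⟩
  -- germs of local equations
  let G₀ : Type u := ∀ x : X, (X.functionField)ˣ ⧸ U x
  letI : CommGroup G₀ := inferInstanceAs (CommGroup (∀ x : X, (X.functionField)ˣ ⧸ U x))
  let diag : (X.functionField)ˣ →* G₀ :=
    { toFun := fun v x => (QuotientGroup.mk v : (X.functionField)ˣ ⧸ U x)
      map_one' := rfl
      map_mul' := fun _ _ => rfl }
  let P : Subgroup G₀ := diag.range
  haveI : P.Normal := inferInstance
  let germ : CartierDivisor X → G₀ := fun D x =>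
    QuotientGroup.mk (Units.mk0 (D.f (D.covers x).choose) (D.f_ne_zero _))
  have germ_spec : ∀ (D : CartierDivisor X) (x : X) (i : D.ι) (hi : x ∈ D.U i),
      germ D x = QuotientGroup.mk (Units.mk0 (D.f i) (D.f_ne_zero i)) := by
    intro D x i hi
    change (QuotientGroup.mk (Units.mk0 (D.f (D.covers x).choose) (D.f_ne_zero _)) :
      (X.functionField)ˣ ⧸ U x) = _
    rw [QuotientGroup.eq, hU]
    have h := D.isUnitAt_div i (D.covers x).choose x hi (D.covers x).choose_spec
    convert h using 1
    simp [div_eq_mul_inv, mul_comm]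
  let cl : CartierDivisor X → Additive (G₀ ⧸ P) := fun D =>
    Additive.ofMul (QuotientGroup.mk (germ D))
  refine ⟨Additive (G₀ ⧸ P), inferInstance, cl, fun D E => ?_, fun D E => ?_⟩
  · -- additivity
    change Additive.ofMul (QuotientGroup.mk (germ (D + E)) : G₀ ⧸ P) =
      Additive.ofMul (QuotientGroup.mk (germ D) : G₀ ⧸ P) +
        Additive.ofMul (QuotientGroup.mk (germ E) : G₀ ⧸ P)
    rw [← ofMul_mul, ← QuotientGroup.mk_mul]
    congr 2
    funext x
    obtain ⟨i, hi⟩ := D.covers x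
    obtain ⟨j, hj⟩ := E.covers x
    have hij : x ∈ (D + E).U (i, j) := ⟨hi, hj⟩
    rw [Pi.mul_apply, germ_spec (D + E) x (i, j) hij, germ_spec D x i hi, germ_spec E x j hj,
      ← QuotientGroup.mk_mul]
    congr 1
    ext
    rfl
  · -- `D ∼ E ↔ cl D = cl E`
    change D.LinEquiv E ↔ Additive.ofMul (QuotientGroup.mk (germ D) : G₀ ⧸ P) =
      Additive.ofMul (QuotientGroup.mk (germ E) : G₀ ⧸ P)
    rw [Additive.ofMul.injective.eq_iff, QuotientGroup.eq, linEquiv_iff]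
    constructor
    · rintro ⟨h, hh, H⟩
      refine ⟨Units.mk0 h hh, funext fun x => ?_⟩
      obtain ⟨i, hi⟩ := D.covers x
      obtain ⟨j, hj⟩ := E.covers x
      change (QuotientGroup.mk (Units.mk0 h hh) : (X.functionField)ˣ ⧸ U x) =
        (germ D x)⁻¹ * germ E x
      rw [germ_spec D x i hi, germ_spec E x j hj, ← QuotientGroup.mk_inv, ← QuotientGroup.mk_mul,
        QuotientGroup.eq, hU]
      have h1 := (H i j x hi hj).inv
      convert h1 using 1
      simp only [Units.val_inv_eq_inv_val, Units.val_mul, Units.val_mk0]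
      field_simp
    · rintro ⟨v, hv⟩
      refine ⟨(v : X.functionField), v.ne_zero, fun i j x hi hj => ?_⟩
      have hx := congrFun hv x
      change (QuotientGroup.mk v : (X.functionField)ˣ ⧸ U x) = (germ D x)⁻¹ * germ E x at hx
      rw [germ_spec D x i hi, germ_spec E x j hj, ← QuotientGroup.mk_inv, ← QuotientGroup.mk_mul,
        QuotientGroup.eq, hU] at hx
      have h1 := hx.inv
      convert h1 using 1
      simp only [Units.val_inv_eq_inv_val, Units.val_mul, Units.val_mk0]
      field_simp


variable {X : Scheme.{u}} [IsIntegral X]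

/-! ### Bookkeeping with an additive class map -/

section ClassMap

variable {Q : Type*} [AddCommGroup Q] {cl : CartierDivisor X → Q}
  (hadd : ∀ D E : CartierDivisor X, cl (D + E) = cl D + cl E)
  (heq : ∀ D E : CartierDivisor X, D.LinEquiv E ↔ cl D = cl E)
include hadd heq

/-- An additive class map kills the zero divisor. [folklore] -/
theorem classMap_zero : cl (0 : CartierDivisor X) = 0 := by
  have h : cl ((0 : CartierDivisor X) + 0) = cl 0 :=
    (heq _ _).1 (add_zero_sameDivisor 0).linEquiv
  rw [hadd] at h
  simpa using h

/-- An additive class map is compatible with multiples. [folklore] -/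
theorem classMap_smul (n : ℕ) (D : CartierDivisor X) : cl (n • D) = n • cl D := by
  induction n with
  | zero =>
    rw [zero_smul]
    exact ((heq _ _).1 (zero_smul_sameDivisor D).linEquiv).trans (classMap_zero hadd heq)
  | succ n ih =>
    rw [(heq _ _).1 (add_smul_sameDivisor D n 1).linEquiv, hadd, ih,
      CartierDivisor.one_smul, add_smul, _root_.one_smul]

/-- An `ℕ`-combination of the classes of effective divisors is the class of an effective divisor.
[folklore] -/
theorem exists_isEffective_classMap_eq_sum {ι : Type*} (s : Finset ι) (c : ι → ℕ)
    (G : ι → CartierDivisor X) (hG : ∀ k ∈ s, (G k).IsEffective) :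
    ∃ E : CartierDivisor X, E.IsEffective ∧ cl E = ∑ k ∈ s, c k • cl (G k) := by
  classical
  induction s using Finset.induction_on with
  | empty => exact ⟨0, isEffective_zero, by rw [classMap_zero hadd heq, Finset.sum_empty]⟩
  | insert a s ha ih =>
    obtain ⟨E, hE, hclE⟩ := ih fun k hk => hG k (Finset.mem_insert_of_mem hk)
    refine ⟨c a • G a + E, ((hG a (Finset.mem_insert_self a s)).smul (c a)).add hE, ?_⟩
    rw [hadd, classMap_smul hadd heq, hclE, Finset.sum_insert ha]

omit heq in
/-- A sum of an ample class and ample classes is the class of an ample divisor. [folklore] -/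
theorem exists_isAmple_classMap_eq_add_sum [X.IsSeparated] {ι : Type*} (s : Finset ι)
    {D : CartierDivisor X} (hD : D.IsAmple) (G : ι → CartierDivisor X)
    (hG : ∀ k ∈ s, (G k).IsAmple) :
    ∃ H : CartierDivisor X, H.IsAmple ∧ cl H = cl D + ∑ k ∈ s, cl (G k) := by
  classical
  induction s using Finset.induction_on with
  | empty => exact ⟨D, hD, by rw [Finset.sum_empty, add_zero]⟩
  | insert a s ha ih =>
    obtain ⟨H, hH, hclH⟩ := ih fun k hk => hG k (Finset.mem_insert_of_mem hk)
    refine ⟨H + G a, hH.add (hG a (Finset.mem_insert_self a s)), ?_⟩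
    rw [hadd, hclH, Finset.sum_insert ha]
    abel

omit hadd heq in
/-- `m • (A + B)` and `m • A + m • B` are the same divisor. [folklore] -/
theorem smul_add_sameDivisor (m : ℕ) (A B : CartierDivisor X) :
    (m • (A + B)).SameDivisor (m • A + m • B) := fun p q x hp hq => by
  change IsUnitAt x ((A.f p.1 * B.f p.2) ^ m / (A.f q.1 ^ m * B.f q.2 ^ m))
  rw [mul_pow, mul_div_mul_comm, ← div_pow, ← div_pow]
  exact ((A.isUnitAt_div _ _ x hp.1 hq.1).pow m).mul ((B.isUnitAt_div _ _ x hp.2 hq.2).pow m)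

omit hadd heq in
/-- A linear equivalence yields an isomorphism of the spaces of global sections (`Nonempty` form of
`sectionsEquivOfLinEquiv`, Görtz–Wedhorn I, Prop. 11.28; the same statement is
`LinEquiv.nonempty_sectionsEquiv` of `Motives/SeesawSemicontinuityKernelRankProofs`, not imported
here to keep this file light). [folklore] -/
theorem nonempty_sectionsEquiv_of_linEquiv (K : Type u) [Field K] [X.Over (Spec (.of K))]
    {D E : CartierDivisor X} (H : D.LinEquiv E) :
    Nonempty (D.sections K ≃ₗ[K] E.sections K) := by
  obtain ⟨h, hh, H⟩ := (linEquiv_iff D E).1 H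
  exact ⟨sectionsEquivOfLinEquiv K hh H⟩

omit hadd heq in
/-- Multiplication by the canonical section `1` of an effective `R`: `Γ(𝒪(B)) ↪ Γ(𝒪(B + R))`.
[folklore] -/
theorem exists_injective_sections_add_of_isEffective (K : Type u) [Field K]
    [X.Over (Spec (.of K))] (B R : CartierDivisor X) (hR : R.IsEffective) :
    ∃ φ : B.sections K →ₗ[K] (B + R).sections K, Function.Injective φ := by
  refine ⟨{ toFun := fun s => ⟨(s : X.functionField), ?_⟩
            map_add' := fun s s' => by ext; rfl
            map_smul' := fun c s => by ext; rfl }, fun s s' h => ?_⟩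
  · have := isSection_add_mul s.2 hR.isSection_one
    rwa [mul_one] at this
  · have h' := congrArg (fun t : (B + R).sections K => (t : X.functionField)) h
    exact Subtype.ext h'

/-- **From a class identity to an embedding of sections**: if `cl A = cl B + cl R` with `R`
effective then `Γ(𝒪(m B)) ↪ Γ(𝒪(m A))` `K`-linearly for every `m` (`m A ∼ m B + m R`, and multiply
by the canonical section of `m R`). [folklore] -/
theorem exists_injective_of_classMap_eq_add (K : Type u) [Field K] [X.Over (Spec (.of K))]
    {A B R : CartierDivisor X} (h : cl A = cl B + cl R) (hR : R.IsEffective) (m : ℕ) :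
    ∃ φ : (m • B).sections K →ₗ[K] (m • A).sections K, Function.Injective φ := by
  have h1 : A.LinEquiv (B + R) := (heq _ _).2 (by rw [hadd, h])
  have h2 : (m • A).LinEquiv (m • B + m • R) :=
    (h1.smul m).trans (smul_add_sameDivisor m B R).linEquiv
  obtain ⟨e⟩ := nonempty_sectionsEquiv_of_linEquiv K h2.symm
  obtain ⟨φ, hφ⟩ := exists_injective_sections_add_of_isEffective K (m • B) (m • R) (hR.smul m)
  exact ⟨e.toLinearMap.comp φ, e.injective.comp hφ⟩

end ClassMap

/-! ### Effective ample representatives -/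

/-- An ample divisor is linearly equivalent to an effective ample one (the divisor of a nonzero
section of a multiple). [folklore] -/
theorem IsAmple.exists_isAmple_isEffective {D₀ : CartierDivisor X}
    (hD₀ : D₀.IsAmple) : ∃ D : CartierDivisor X, D.IsAmple ∧ D.IsEffective := by
  obtain ⟨n₀, hn₀⟩ := hD₀.exists_forall_le_isSection_ne_zero
  obtain ⟨s, hs, hs0⟩ := hn₀ (n₀ + 1) (Nat.le_succ _)
  refine ⟨(n₀ + 1) • D₀ + principal s hs0, ?_, fun p x hp => hs p.1 x hp.1⟩
  exact LinEquiv.isAmple ⟨s, hs0, SameDivisor.refl _⟩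
    (hD₀.smul (Nat.succ_pos n₀))

/-! ### Comparison of asymptotic degrees along embeddings of sections -/

/-- **Leading coefficients compare along embeddings of sections.** If `h⁰(m P) = δ_P m^g/g! + O(m^{g-1})`,
`h⁰(m H) = δ_H m^g/g! + O(m^{g-1})` with `δ_H > 0`, and `Γ(𝒪(m P)) ↪ Γ(𝒪((M m) H))` for all large
`m` (`M ≥ 1`), then `δ_P ≤ δ_H M^g`. [folklore] -/
theorem le_of_injective_sections (K : Type u) [Field K] [X.Over (Spec (.of K))]
    {P H : CartierDivisor X} {g δP δH M : ℕ} (hP : P.HasAsympDegree K g δP)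
    (hH : H.HasAsympDegree K g δH) (hδH : 0 < δH) (hM : 0 < M)
    (hinj : ∀ᶠ m : ℕ in atTop,
      ∃ φ : (m • P).sections K →ₗ[K] (m • (M • H)).sections K, Function.Injective φ) :
    δP ≤ δH * M ^ g := by
  -- finite-dimensionality of `Γ((M m) H)` for large `m`
  have hfin := hH.eventually_finiteDimensional hδH
  rw [Filter.eventually_atTop] at hfin
  obtain ⟨n₀, hn₀⟩ := hfin
  have hle : ∀ᶠ m : ℕ in atTop, ((m • P).h0 K : ℝ) ≤ (((M * m) • H).h0 K : ℝ) := by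
    filter_upwards [hinj, eventually_ge_atTop n₀] with m ⟨φ, hφ⟩ hm
    haveI : FiniteDimensional K ((m • (M • H)).sections K) := by
      rw [CartierDivisor.smul_smul]
      exact hn₀ _ (le_trans hm (Nat.le_mul_of_pos_left m hM))
    have h := LinearMap.finrank_le_finrank_of_injective hφ
    change (m • P).h0 K ≤ (m • (M • H)).h0 K at h
    rw [CartierDivisor.smul_smul] at h
    exact_mod_cast h
  -- limits of both sides divided by `m^g`
  have h1 : Tendsto (fun m : ℕ => ((m • P).h0 K : ℝ) / (m : ℝ) ^ g) atTop
      (𝓝 ((δP : ℝ) / g.factorial)) := tendsto_div_pow_of_isBigO hP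
  have hH' := isBigO_comp_mul (u := fun N : ℕ => ((N • H).h0 K : ℝ)) hM hH
  have h2 : Tendsto (fun m : ℕ => (((M * m) • H).h0 K : ℝ) / (m : ℝ) ^ g) atTop
      (𝓝 ((δH : ℝ) * (M : ℝ) ^ g / g.factorial)) :=
    tendsto_div_pow_of_isBigO (α := (δH : ℝ) * (M : ℝ) ^ g) hH'
  have h3 : (δP : ℝ) / g.factorial ≤ (δH : ℝ) * (M : ℝ) ^ g / g.factorial := by
    refine le_of_tendsto_of_tendsto h1 h2 ?_
    filter_upwards [hle] with m hm
    exact div_le_div_of_nonneg_right hm (pow_nonneg (Nat.cast_nonneg _) _)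
  have hfac : (0 : ℝ) < g.factorial := Nat.cast_pos.2 (Nat.factorial_pos g)
  rw [div_le_div_iff_of_pos_right hfac] at h3
  exact_mod_cast h3

end CartierDivisor

end Literature.AlgebraicGeometry.Motives
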